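import Summits.Langlands.Langlands.Theses.E8QuinticResidue
import HarnessLib

/-!
# `E8QuinticResidue.A5PolePattern` (stmt-Langlands-8671) — proved by kernel decision

[proof of `Summit.Langlands.Langlands.Theses.E8QuinticResidue.A5PolePattern`
(route `E8QuinticResidue`, support item, rank 9; the card's item P1 / cheapest falsifier)]

**Statement.**  With `χ g = #Fix(g) − 1` (the character `χ₄` of the 4-dimensional irreducible
representation of `A₅`, the standard representation minus the trivial one) and
`ψ g = χ(g)² + χ(g²) − 2χ(g) − 2 = 2·(Sym²χ₄ − χ₄ − 1)(g) = 2χ₅(g)` (twice the character of the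
5-dimensional irreducible representation), the seven sums over the sixty elements of `A₅` are
`Σ χ = 0`, `Σ χ² = 60`, `Σ ψ² = 240`, `Σ ψχ = 0`, `Σ ψ(χ² − χ(g²)) = 0`, `Σ (ψ² − 2ψ(g²)) = 0`,
`Σ (ψ² − 2ψ(g²))χ = 480` — i.e. `⟨χ₄,1⟩ = 0`, `⟨χ₄,χ₄⟩ = 1`, `⟨χ₅,χ₅⟩ = 1`, `⟨χ₅χ₄,1⟩ = 0`,
`⟨χ₅·∧²χ₄,1⟩ = 0`, `⟨∧²χ₅,1⟩ = 0`, `⟨∧²χ₅·χ₄,1⟩ = 1`: the pole pattern of the five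
Langlands–Shahidi `L`-functions `L(s, σ_L, r_i)` of `(E₈, A₃ × A₄)` restricted to `A₅` through
`(ρ₄, ρ₅)` — a unique simple pole, coming from `r₁`.

**Proof.**  The two hypotheses determine `χ` and `ψ` as explicit functions on the finite type
`alternatingGroup (Fin 5)` (`funext` + `subst`); the resulting closed conjunction of seven integer
equalities is decidable and is evaluated by the kernel (`decide +kernel`: the sixty even
permutations of `Fin 5` are enumerated through Mathlib's computable `Fintype (Equiv.Perm (Fin 5))`
and `Equiv.Perm.sign`).  No `native_decide`, no named fact, no hypothesis beyond the item's own;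
axioms `propext`, `Classical.choice`, `Quot.sound` only. -/

set_option linter.dupNamespace false

namespace Summit.Langlands.Langlands.Theorems.E8QuinticResidueA5PolePattern

open Summit.Langlands.Langlands.Theses.E8QuinticResidue

/-- **stmt-Langlands-8671** `E8QuinticResidue.A5PolePattern`: the seven character sums over `A₅`
(irreducibility of `χ₄`, `χ₅` and the multiplicities `⟨4,1⟩ = ⟨5⊗4,1⟩ = ⟨5⊗∧²4,1⟩ = ⟨∧²5,1⟩ = 0`,
`⟨∧²5⊗4,1⟩ = 1`), decided by the kernel after substituting the two defining hypotheses. -/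
theorem a5PolePattern : A5PolePattern := by
  intro χ ψ hχ hψ
  have hψ' : ψ = fun g => χ g ^ 2 + χ (g ^ 2) - 2 * χ g - 2 := funext hψ
  have hχ' : χ = fun g : alternatingGroup (Fin 5) =>
      (((Finset.univ.filter fun i : Fin 5 => (g : Equiv.Perm (Fin 5)) i = i).card : ℤ) - 1) :=
    funext hχ
  subst hψ'
  subst hχ'
  clear hχ hψ
  decide +kernel

end Summit.Langlands.Langlands.Theorems.E8QuinticResidueA5PolePattern
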